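import Summits.BirchSwinnertonDyer.Rank1Residual.P2.CongruentClassSevenConfigurations
import Summits.BirchSwinnertonDyer.Rank1Residual.P2.CongruentNumberPairsAtTwoGenusRedei
import Literature.NumberTheory.EllipticCurves.FaulknerJames2007.RhoIndexEvenPartitionBound
import HarnessLib

/-!
# Sub-lane «bsd-p2»: the data of a prime tuple ARE functions of its Legendre configuration
# (§2–§4 of the series: reciprocity for `kroneckerBit`; the FJ Laplacian; `g(d) mod 2` modulo Rédei–Reichardt)

HONEST FRAMING (sub-lane «bsd-p2», run/shared/lean/b2b/bsd-rank1-residual/p2/, verbatim in every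
file): the target of record is the FULL Birch–Swinnerton-Dyer formula for EVERY analytic-rank `≤ 1`
`E/ℚ` at ALL primes INCLUDING `2`; the odd-prime class ledger is referee A's; the `2`-part is OPEN
(cells O1 = X5 ∖ CM and O12 = the CM corner) and under census by «bsd-p2». Census / instrument
output at `2` = EVIDENCE / conjecture items with held-out validation, NEVER a Literature fact;
certificates close PAIRS (one isogeny class, `p = 2`), never classes. This file asserts NO
arithmetic fact: the only journal input is the DISPLAYED Rédei–Reichardt fact `hR`
(`redeiReichardt_fourTwoCard_classGroup`, Li–Ma 2008 Thm 0.4, p319707); everything is PROVED.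

WHAT IT DOES. §2: the computable additive symbol `kroneckerBit` of `RedeiMatrixFourRank.lean` obeys
quadratic reciprocity `[(ℓ/q)=−1] = [(q/ℓ)=−1] + [ℓ≡3][q≡3 (4)]`, the first supplement, `[(−4/q)=−1] =
[q ≡ 3 (4)]`, and Cox's `[(D_ℓ/2) = −1] = [ℓ ≡ ±3 (8)]` (from `kroneckerBit_eq_one_iff_jacobiSym` and
Mathlib's `jacobiSym.quadratic_reciprocity*`). §3: `fjLaplacianNeg p = fjCfg (pᵢ mod 8, bits)`
(definitional). §4: modulo `hR`, for distinct odd primes `g(∏ qᵢ) mod 2 = gBitCfg (configuration)`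
through the door file's `odd_genusClassNumber_genusField_iff_card_ker` on `ι = Fin m` resp.
`Option (Fin m)` (Li–Ma's primes of `D = −d` resp. `−4d`). Part of the five-file series `CongruentClassSevenConfigurations` (§1: configurations + the finite
check) → `CongruentClassSevenConfigTransfer` (§2–§4: the prime tuple's data ARE functions of its
Legendre configuration) → `DecompositionsThreePrimes` (§5a) → `GenusSumsThreePrimes` (§5b) →
`CongruentClassSevenKernelGenusParity` (§6: the `hgen`-free lemma for `ω(n) = 3` and the family door);
WAKE-theoremU of p2-lead ML-42 (W1′), source p2-idea-2 `O-rhoG-NOTE.md` v0.4 §8–§9, dictionary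
countersigned in `p2/monsky/lit/A44-REDEI-GRAPH-COUNTERSIGN.md`. Unit `b2b-bsdres-p2-monsky-lit` GEN 7; NEW file.

References: [IrelandRosen1990] Ch. 5 §1 Prop. 5.1.2–5.1.3, §2 Thm 1; [LiMa2008] Lemma 0.1, Def. 0.2,
Thm 0.4; [Cox2013] §5.B; [FaulknerJames2007] Def. 1.5, Def. 5.2; [TianYuanZhang2017] §1 (g(d));
[HardyWright2008] §1.3, §5.2.
-/

open Matrix Finset NumberField Literature.NumberTheory.EllipticCurves
  Literature.NumberTheory.EllipticCurves.HeathBrown1994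
  Literature.NumberTheory.EllipticCurves.TianYuanZhang2017
  Literature.NumberTheory.EllipticCurves.FaulknerJames2007
  Literature.NumberTheory.QuadraticFields.RedeiReichardt

set_option autoImplicit false

namespace Summit.BirchSwinnertonDyer.Rank1Residual.P2

/-! ## §2 The additive Legendre symbol `kroneckerBit`: reciprocity, `(−1/q)`, `(−4/q)`, `(D/2)` (proved) -/

section Kronecker

/-- `kroneckerBit a q` for an odd prime `q ∤ a` is the bit `[(a/q) = −1]` (Euler's criterion, proved in
`RedeiMatrixFourRank.lean`). [cite: IrelandRosen1990, Ch. 5 §1 Prop. 5.1.2 (Euler's criterion)] -/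
theorem kroneckerBit_eq_bitOf {a : ℤ} {q : ℕ} (hq : q.Prime) (hq2 : q ≠ 2)
    (ha : ((a : ZMod q)) ≠ 0) : kroneckerBit a q = bitOf (jacobiSym a q = -1) := by
  unfold bitOf
  by_cases h : jacobiSym a q = -1
  · rw [if_pos h]; exact (kroneckerBit_eq_one_iff_jacobiSym hq hq2 ha).mpr h
  · rw [if_neg h]
    have h01 : kroneckerBit a q = 0 ∨ kroneckerBit a q = 1 := by
      unfold kroneckerBit; split_ifs <;> simp
    rcases h01 with h0 | h1
    · exact h0
    · exact absurd ((kroneckerBit_eq_one_iff_jacobiSym hq hq2 ha).mp h1) h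

/-- Additivity of the bit on signs: `[uv = −1] = [u = −1] + [v = −1]` for `u, v ∈ {±1}`.
[cite: IrelandRosen1990, Ch. 5 §1 Prop. 5.1.2 (multiplicativity of the Legendre symbol)] -/
theorem bitOf_mul_eq_neg_one {u v : ℤ} (hu : u = 1 ∨ u = -1) (hv : v = 1 ∨ v = -1) :
    bitOf (u * v = -1) = bitOf (u = -1) + bitOf (v = -1) := by
  rcases hu with rfl | rfl <;> rcases hv with rfl | rfl <;> decide

/-- A prime `ℓ ≠ q` is a unit mod the prime `q`. [cite: HardyWright2008, §1.3 Thm. 2] -/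
theorem intCast_natCast_prime_ne_zero {ℓ q : ℕ} (hℓ : ℓ.Prime) (hq : q.Prime) (hne : ℓ ≠ q) :
    (((ℓ : ℤ) : ZMod q)) ≠ 0 := by
  rw [Ne, ZMod.intCast_zmod_eq_zero_iff_dvd, Int.natCast_dvd_natCast, Nat.prime_dvd_prime_iff_eq hq hℓ]
  exact fun h => hne h.symm

/-- `gcd(ℓ, q) = 1` for distinct primes, in the form the Jacobi-symbol API wants. [cite: HardyWright2008, §1.3 Thm. 2] -/
theorem int_gcd_prime_eq_one {ℓ q : ℕ} (hℓ : ℓ.Prime) (hq : q.Prime) (hne : ℓ ≠ q) :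
    Int.gcd (ℓ : ℤ) (q : ℤ) = 1 := by
  rw [Int.gcd_natCast_natCast]
  exact (Nat.coprime_primes hℓ hq).mpr hne

/-- An odd prime is `≡ 1` or `≡ 3 (mod 4)`. [cite: HardyWright2008, §5.2 (residue classes)] -/
theorem prime_mod_four {q : ℕ} (hq : q.Prime) (hq2 : q ≠ 2) : q % 4 = 1 ∨ q % 4 = 3 := by
  have h2 : ¬ 2 ∣ q := fun h =>
    hq2 ((hq.eq_one_or_self_of_dvd 2 h).resolve_left (by norm_num)).symm
  omega

/-- `chi4Bit` depends only on the residue mod `8` (indeed mod `4`). [cite: IrelandRosen1990, Ch. 5 §1] -/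
theorem chi4Bit_mod_eight (x : ℕ) : chi4Bit (x % 8) = chi4Bit x := by
  unfold chi4Bit; rw [Nat.mod_mod_of_dvd x (by norm_num : 4 ∣ 8)]

/-- `chi8Bit` depends only on the residue mod `8`. [cite: IrelandRosen1990, Ch. 5 §1] -/
theorem chi8Bit_mod_eight (x : ℕ) : chi8Bit (x % 8) = chi8Bit x := by
  unfold chi8Bit; rw [Nat.mod_mod]

/-- **Quadratic reciprocity for the bits**: for distinct odd primes `ℓ, q`,
`[(ℓ/q) = −1] = [(q/ℓ) = −1] + [ℓ ≡ 3 (4)]·[q ≡ 3 (4)]`.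
[cite: IrelandRosen1990, Ch. 5 §2 Thm. 1 (law of quadratic reciprocity)] -/
theorem kroneckerBit_swap {ℓ q : ℕ} (hℓ : ℓ.Prime) (hq : q.Prime) (hℓ2 : ℓ ≠ 2) (hq2 : q ≠ 2)
    (hne : ℓ ≠ q) : kroneckerBit ℓ q = kroneckerBit q ℓ + chi4Bit ℓ * chi4Bit q := by
  rw [kroneckerBit_eq_bitOf hq hq2 (intCast_natCast_prime_ne_zero hℓ hq hne),
    kroneckerBit_eq_bitOf hℓ hℓ2 (intCast_natCast_prime_ne_zero hq hℓ hne.symm)]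
  have hqodd : Odd q := hq.odd_of_ne_two hq2
  have hℓodd : Odd ℓ := hℓ.odd_of_ne_two hℓ2
  have hv : jacobiSym (q : ℤ) ℓ = 1 ∨ jacobiSym (q : ℤ) ℓ = -1 :=
    jacobiSym.eq_one_or_neg_one (int_gcd_prime_eq_one hq hℓ hne.symm)
  rcases prime_mod_four hℓ hℓ2 with h1 | h3
  · rw [jacobiSym.quadratic_reciprocity_one_mod_four h1 hqodd]
    simp [chi4Bit, h1]
  · rcases prime_mod_four hq hq2 with h1' | h3'
    · rw [jacobiSym.quadratic_reciprocity_one_mod_four' hℓodd h1']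
      simp [chi4Bit, h1']
    · rw [jacobiSym.quadratic_reciprocity_three_mod_four h3 h3']
      have : chi4Bit ℓ * chi4Bit q = 1 := by simp [chi4Bit, h3, h3']
      rw [this]
      unfold bitOf
      rcases hv with h | h <;> rw [h] <;> decide

/-- **First supplement**: for an odd prime `q` and a prime `ℓ ≠ q`,
`[(−ℓ/q) = −1] = [(ℓ/q) = −1] + [q ≡ 3 (4)]`.
[cite: IrelandRosen1990, Ch. 5 §1 Prop. 5.1.2 Cor. ((−1/p) = (−1)^{(p−1)/2})] -/
theorem kroneckerBit_neg {ℓ q : ℕ} (hℓ : ℓ.Prime) (hq : q.Prime) (hq2 : q ≠ 2) (hne : ℓ ≠ q) :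
    kroneckerBit (-(ℓ : ℤ)) q = kroneckerBit ℓ q + chi4Bit q := by
  have hne0 := intCast_natCast_prime_ne_zero hℓ hq hne
  have hne0' : (((-(ℓ : ℤ) : ℤ) : ZMod q)) ≠ 0 := by
    rw [Int.cast_neg]; exact neg_ne_zero.mpr hne0
  rw [kroneckerBit_eq_bitOf hq hq2 hne0', kroneckerBit_eq_bitOf hq hq2 hne0,
    jacobiSym.neg _ (hq.odd_of_ne_two hq2), ZMod.χ₄_nat_eq_if_mod_four]
  have hv : jacobiSym (ℓ : ℤ) q = 1 ∨ jacobiSym (ℓ : ℤ) q = -1 :=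
    jacobiSym.eq_one_or_neg_one (int_gcd_prime_eq_one hℓ hq hne)
  have hodd : q % 2 = 1 := Nat.odd_iff.mp (hq.odd_of_ne_two hq2)
  have hodd' : ¬ q % 2 = 0 := by omega
  rcases prime_mod_four hq hq2 with h1 | h3
  · simp only [hodd', h1, if_true, if_false, one_mul]
    simp [chi4Bit, h1]
  · have h41 : ¬ q % 4 = 1 := by omega
    simp only [hodd', h41, if_false, neg_one_mul]
    have hc : chi4Bit q = 1 := by simp [chi4Bit, h3]
    rw [hc]
    unfold bitOf
    rcases hv with h | h <;> rw [h] <;> decide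

/-- **The Rédei entry `[(D_ℓ / q) = −1]`** for odd primes `ℓ ≠ q`, with `D_ℓ = ±ℓ ≡ 1 (mod 4)`:
`= [(ℓ/q) = −1] + [q ≡ 3 (4)]·[ℓ ≡ 3 (4)]`. [cite: LiMa2008, Lemma 0.1 and Def. 0.2 (p. 279)] -/
theorem kroneckerBit_primeDisc {d ℓ q : ℕ} (hℓ : ℓ.Prime) (hq : q.Prime) (hℓ2 : ℓ ≠ 2) (hq2 : q ≠ 2)
    (hne : ℓ ≠ q) : kroneckerBit (primeDisc d ℓ) q = kroneckerBit ℓ q + chi4Bit q * chi4Bit ℓ := by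
  rw [primeDisc_of_ne_two d hℓ2]
  rcases prime_mod_four hℓ hℓ2 with h1 | h3
  · rw [if_pos h1]
    simp [chi4Bit, h1]
  · rw [if_neg (by omega), kroneckerBit_neg hℓ hq hq2 hne]
    simp [chi4Bit, h3]

/-- `[(−4/q) = −1] = [q ≡ 3 (mod 4)]` for an odd prime `q` (`(−4/q) = (−1/q)`).
[cite: IrelandRosen1990, Ch. 5 §1 Prop. 5.1.2 Cor.] [cite: LiMa2008, Lemma 0.1 (D₁ = −4)] -/
theorem kroneckerBit_neg_four {q : ℕ} (hq : q.Prime) (hq2 : q ≠ 2) :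
    kroneckerBit (-4) q = chi4Bit q := by
  have hqodd : Odd q := hq.odd_of_ne_two hq2
  have h2 : Int.gcd (2 : ℤ) (q : ℤ) = 1 := by
    rw [show (2 : ℤ) = ((2 : ℕ) : ℤ) by rfl, Int.gcd_natCast_natCast]
    exact (Nat.coprime_primes Nat.prime_two hq).mpr (fun h => hq2 h.symm)
  have hne0 : (((-4 : ℤ) : ZMod q)) ≠ 0 := by
    rw [Ne, ZMod.intCast_zmod_eq_zero_iff_dvd]
    intro h
    have h4 : (q : ℤ) ∣ 4 := (dvd_neg).mp h
    have hq4 : q ∣ 4 := by exact_mod_cast h4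
    have h22 : q ∣ 2 * 2 := by simpa using hq4
    rcases (Nat.Prime.dvd_mul hq).mp h22 with h | h <;>
      exact hq2 ((Nat.prime_dvd_prime_iff_eq hq Nat.prime_two).mp h)
  rw [kroneckerBit_eq_bitOf hq hq2 hne0, show (-4 : ℤ) = -(2 ^ 2) by norm_num,
    jacobiSym.neg _ hqodd, jacobiSym.sq_one' h2, mul_one, ZMod.χ₄_nat_eq_if_mod_four]
  have hodd' : ¬ q % 2 = 0 := by have := Nat.odd_iff.mp hqodd; omega
  rcases prime_mod_four hq hq2 with h1 | h3
  · simp [hodd', h1, chi4Bit, bitOf]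
  · have h41 : ¬ q % 4 = 1 := by omega
    simp only [hodd', h41, if_false]
    simp [chi4Bit, h3, bitOf]

/-- `[(D_ℓ / 2) = −1] = [ℓ ≡ ±3 (mod 8)]` for an odd prime `ℓ` (Cox's Kronecker symbol at `2`:
`(D/2) = −1 ⟺ D ≡ 5 (mod 8)`, with `D_ℓ = ℓ` for `ℓ ≡ 1 (4)` and `−ℓ` for `ℓ ≡ 3 (4)`).
[cite: Cox2013, §5.B (definition of (D/2), before Prop. 5.16)] [cite: LiMa2008, Lemma 0.1] -/
theorem kroneckerBit_primeDisc_two {d ℓ : ℕ} (hℓ : ℓ.Prime) (hℓ2 : ℓ ≠ 2) :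
    kroneckerBit (primeDisc d ℓ) 2 = chi8Bit ℓ := by
  rw [kroneckerBit_two, primeDisc_of_ne_two d hℓ2]
  unfold chi8Bit
  have hodd : ℓ % 2 = 1 := Nat.odd_iff.mp (hℓ.odd_of_ne_two hℓ2)
  by_cases h1 : ℓ % 4 = 1
  · rw [if_pos h1]
    by_cases h5 : ℓ % 8 = 5
    · have : (ℓ : ℤ) % 8 = 5 := by omega
      rw [if_pos this, if_pos (Or.inr h5)]
    · have : ¬ (ℓ : ℤ) % 8 = 5 := by omega
      rw [if_neg this, if_neg (by omega)]
  · rw [if_neg h1]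
    by_cases h3 : ℓ % 8 = 3
    · have : (-(ℓ : ℤ)) % 8 = 5 := by omega
      rw [if_pos this, if_pos (Or.inl h3)]
    · have : ¬ (-(ℓ : ℤ)) % 8 = 5 := by omega
      rw [if_neg this, if_neg (by omega)]

end Kronecker

/-! ## §3 The Faulkner–James Laplacian IS a function of the configuration (definitional) -/

section TransferFJ

variable {t : ℕ}

/-- The arc indicator of `G(−n)` read on the primes equals the one read on their configuration
`(pᵢ mod 8, [(p_b/p_a) = −1])`. [cite: FaulknerJames2007, Def. 1.5] -/
theorem fjArcNeg_eq_fjArcCfg (p : Fin t → ℕ) :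
    fjArcNeg p = fjArcCfg (fun i => p i % 8) (fun a b => kroneckerBit (p b) (p a)) := by
  funext i j
  unfold fjArcNeg fjArcCfg chi8Bit
  simp only [Nat.mod_mod, Nat.mod_mod_of_dvd _ (by norm_num : 4 ∣ 8)]

/-- **Transfer (FJ side).** `L(G(−n)) = fjCfg (configuration of the prime tuple)`.
[cite: FaulknerJames2007, Def. 5.2 and Lemma 5.1] -/
theorem fjLaplacianNeg_eq_fjCfg (p : Fin t → ℕ) :
    fjLaplacianNeg p = fjCfg (fun i => p i % 8) (fun a b => kroneckerBit (p b) (p a)) := by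
  unfold fjLaplacianNeg fjCfg
  rw [fjArcNeg_eq_fjArcCfg]

end TransferFJ

/-! ## §4 `g(d) mod 2` IS a function of the configuration (modulo Rédei–Reichardt) -/

section TransferGenus

variable {m : ℕ}

/-- Two "row-sum" matrices agree when their off-diagonal entry functions agree off the diagonal.
[cite: LiMa2008, Def. 0.2 (r_ii = Σ_{j≠i} r_ij)] -/
theorem of_rowsum_congr {ι : Type*} [Fintype ι] [DecidableEq ι] {f g : ι → ι → ZMod 2}
    (h : ∀ a b, a ≠ b → f a b = g a b) :
    (Matrix.of fun a b => if a = b then ∑ c ∈ univ.erase a, f a c else f a b) =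
      Matrix.of fun a b => if a = b then ∑ c ∈ univ.erase a, g a c else g a b := by
  ext a b
  simp only [Matrix.of_apply]
  split_ifs with hab
  · exact Finset.sum_congr rfl fun c hc => h a c (Finset.ne_of_mem_erase hc).symm
  · exact h a b hab

/-- `(n mod 2) = [P]` from `Odd n ↔ P`. [cite: HardyWright2008, §5.2 (residues)] -/
theorem natCast_eq_bitOf_of_iff {n : ℕ} {P : Prop} [Decidable P] (h : Odd n ↔ P) :
    (n : ZMod 2) = if P then 1 else 0 := by
  by_cases hP : P
  · rw [if_pos hP]; exact ZMod.natCast_eq_one_iff_odd.mpr (h.mpr hP)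
  · rw [if_neg hP]
    exact ZMod.natCast_eq_zero_iff_even.mpr (Nat.not_odd_iff_even.mp fun ho => hP (h.mp ho))

/-- `(∏ qᵢ) mod 4` from the residues `qᵢ mod 8`. [cite: HardyWright2008, §5.2 (residues)] -/
theorem prod_mod_four_eq (q : Fin m → ℕ) : (∏ i, q i) % 4 = (∏ i, q i % 8) % 4 := by
  rw [← Nat.mod_mod_of_dvd (∏ i, q i) (by norm_num : 4 ∣ 8), Finset.prod_nat_mod,
    Nat.mod_mod_of_dvd _ (by norm_num : 4 ∣ 8)]

/-- **Transfer (genus side).** Modulo Rédei–Reichardt (`hR`): for distinct ODD primes `q₀, …, q_{m−1}`,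
`g(∏ qᵢ) mod 2 = gBitCfg (qᵢ mod 8, [(q_b/q_a) = −1])` — the parity of `#2Cl(ℚ(√−∏qᵢ))` is the
Rédei-kernel bit computed on the configuration (Li–Ma's `RM(D)` for `D = −d` resp. `−4d`, entries by
§2). [cite: LiMa2008, Thm. 0.4 (p. 280) with Lemma 0.1, Def. 0.2 (p. 279)] [cite: TianYuanZhang2017, §1 (p0002 L78–L86)] -/
theorem natCast_genusClassNumber_eq_gBitCfg (hR : redeiReichardt_fourTwoCard_classGroup)
    (q : Fin m → ℕ) (hq : ∀ i, (q i).Prime) (hq2 : ∀ i, q i ≠ 2) (hinj : Function.Injective q) :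
    ((genusClassNumber (GenusField (∏ i, q i)) : ℕ) : ZMod 2) =
      gBitCfg (fun i => q i % 8) (fun a b => kroneckerBit (q b) (q a)) := by
  set d := ∏ i, q i with hd
  -- off-diagonal Rédei entries between odd primes
  have hent : ∀ a b : Fin m, a ≠ b → kroneckerBit (primeDisc d (q b)) (q a) =
      redeiEntryCfg (fun i => q i % 8) (fun a b => kroneckerBit (q b) (q a)) a b := by
    intro a b hab
    unfold redeiEntryCfg
    rw [chi4Bit_mod_eight, chi4Bit_mod_eight]
    exact kroneckerBit_primeDisc (hq b) (hq a) (hq2 b) (hq2 a) (fun h => hab (hinj h).symm)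
  have h4iff : d % 4 = 1 ↔ (∏ i, q i % 8) % 4 = 1 := by rw [← prod_mod_four_eq q]
  unfold gBitCfg
  by_cases h4 : d % 4 = 1
  · -- `d ≡ 1 (mod 4)`: `D = −4d`, primes `2, q₀, …` on `Option (Fin m)`
    rw [if_pos (h4iff.mp h4)]
    set qq : Option (Fin m) → ℕ := fun o => o.elim 2 q with hqq
    have hprod : ∏ o, qq o = if d % 4 = 1 then 2 * d else d := by
      rw [if_pos h4, Fintype.prod_option]
      simp [hqq, hd]
    have hq' : ∀ o, (qq o).Prime := by
      rintro (_ | a)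
      · exact Nat.prime_two
      · exact hq a
    have hinj' : Function.Injective qq := by
      rintro (_ | a) (_ | b) h
      · rfl
      · exact absurd (by simpa [hqq] using h.symm) (hq2 b)
      · exact absurd (by simpa [hqq] using h) (hq2 a)
      · exact congrArg some (hinj (by simpa [hqq] using h))
    have key := odd_genusClassNumber_genusField_iff_card_ker hR qq hq' hinj' hprod
    have hmat : (Matrix.of fun a b : Option (Fin m) =>
        if a = b then ∑ c ∈ univ.erase a, kroneckerBit (primeDisc d (qq c)) (qq a)
        else kroneckerBit (primeDisc d (qq b)) (qq a)) =
        redeiCfgEven (fun i => q i % 8) (fun a b => kroneckerBit (q b) (q a)) := by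
      unfold redeiCfgEven
      apply of_rowsum_congr
      rintro (_ | a) (_ | b) hab
      · exact absurd rfl hab
      · simp only [hqq, Option.elim_none, Option.elim_some, redeiEntryCfgEven]
        rw [chi8Bit_mod_eight]
        exact kroneckerBit_primeDisc_two (hq b) (hq2 b)
      · simp only [hqq, Option.elim_none, Option.elim_some, redeiEntryCfgEven]
        rw [chi4Bit_mod_eight]
        have h2 : primeDisc d 2 = -4 := by simp [primeDisc, h4]
        rw [h2]
        exact kroneckerBit_neg_four (hq a) (hq2 a)
      · simp only [hqq, Option.elim_some, redeiEntryCfgEven]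
        exact hent a b (fun h => hab (congrArg some h))
    have hcard : Fintype.card {v : Option (Fin m) → ZMod 2 // (Matrix.of fun a b : Option (Fin m) =>
        if a = b then ∑ c ∈ univ.erase a, kroneckerBit (primeDisc d (qq c)) (qq a)
        else kroneckerBit (primeDisc d (qq b)) (qq a)) *ᵥ v = 0} =
        Fintype.card {v : Option (Fin m) → ZMod 2 //
          redeiCfgEven (fun i => q i % 8) (fun a b => kroneckerBit (q b) (q a)) *ᵥ v = 0} :=
      Fintype.card_congr (Equiv.subtypeEquivRight fun v => by rw [hmat])
    rw [natCast_eq_bitOf_of_iff key, hcard]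
  · -- `d ≡ 3 (mod 4)`: `D = −d`, primes `q₀, …` on `Fin m`
    rw [if_neg (fun h => h4 (h4iff.mpr h))]
    have hprod : ∏ i, q i = if d % 4 = 1 then 2 * d else d := by rw [if_neg h4]
    have key := odd_genusClassNumber_genusField_iff_card_ker hR q hq hinj hprod
    have hmat : (Matrix.of fun a b : Fin m =>
        if a = b then ∑ c ∈ univ.erase a, kroneckerBit (primeDisc d (q c)) (q a)
        else kroneckerBit (primeDisc d (q b)) (q a)) =
        redeiCfgOdd (fun i => q i % 8) (fun a b => kroneckerBit (q b) (q a)) := by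
      unfold redeiCfgOdd
      exact of_rowsum_congr hent
    have hcard : Fintype.card {v : Fin m → ZMod 2 // (Matrix.of fun a b : Fin m =>
        if a = b then ∑ c ∈ univ.erase a, kroneckerBit (primeDisc d (q c)) (q a)
        else kroneckerBit (primeDisc d (q b)) (q a)) *ᵥ v = 0} =
        Fintype.card {v : Fin m → ZMod 2 //
          redeiCfgOdd (fun i => q i % 8) (fun a b => kroneckerBit (q b) (q a)) *ᵥ v = 0} :=
      Fintype.card_congr (Equiv.subtypeEquivRight fun v => by rw [hmat])
    rw [natCast_eq_bitOf_of_iff key, hcard]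

/-- **Transfer for a sub-product of a prime triple** (`d_T = ∏_{i} p_{e i}` for an injective
`e : Fin m → Fin 3`): `g(d_T) mod 2 = gBitSub e (configuration of p)`.
[cite: LiMa2008, Thm. 0.4 (p. 280)] [cite: TianYuanZhang2017, §1 (p0002 L78–L86)] -/
theorem natCast_genusClassNumber_eq_gBitSub (hR : redeiReichardt_fourTwoCard_classGroup)
    (p : Fin 3 → ℕ) (hp : ∀ i, (p i).Prime) (hp2 : ∀ i, p i ≠ 2) (hinj : Function.Injective p)
    (e : Fin m → Fin 3) (he : Function.Injective e) :
    ((genusClassNumber (GenusField (∏ i, p (e i))) : ℕ) : ZMod 2) =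
      gBitSub e (fun i => p i % 8) (fun a b => kroneckerBit (p b) (p a)) := by
  unfold gBitSub
  exact natCast_genusClassNumber_eq_gBitCfg hR (fun i => p (e i)) (fun i => hp (e i))
    (fun i => hp2 (e i)) (hinj.comp he)

end TransferGenus

end Summit.BirchSwinnertonDyer.Rank1Residual.P2
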